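import Mathlib
import Summits.Ventures.PercRepro2.CoinChainMixedCentreChain
import Summits.Ventures.PercRepro2.CoinChainQstar
import Summits.Ventures.PercRepro2.CoinChainBernsteinDarc

/-!
# The universal PURE chain from a SIGN condition on the pivotal law
(blind cell PercRepro2, night-2 g23; proofs/NIGHT2-DARC.md §63)

Pure chain (`ent = ∅`): world-0 law `ν·c` (moments `a0 a1 a2`), world-1 `R`-law
`ν·chainMix ∅ ent' 1 c d` (`b0 b1 b2`), world-1 gate `ν·chainMix ∅ ent' 1 c d'` (`g0 g1 g2 g12`),
pivotal law `R¹ − G¹` (mass `b0 − g0`, marker moments `b1 − g1`, `b2 − g2`).  The mixed-centre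
theorem `chain_world1_mixed_nonneg` at `(ρ₁, ρ₂) = (1, 0)` says that the gate centred at the
world-1 `x`-mean and the world-0 `y`-mean has nonnegative cleared functional:

  `U101 = b0 a0 g12 − b0 a2 g1 − a0 b1 g2 + b1 a2 g0 ≥ 0`.

THE IDENTITY (`qprime_pivotalX_identity`, a ring identity):

  `a0²·U111 + (b0 − g0)·Δ = a0 b0·U101 − b0·(b0 a2 − a0 b2)·(a0 (b1 − g1) − a1 (b0 − g0))`,

so (Q′) — `a0²·U111 + (b0 − g0)·Δ ≥ 0`, the statement of record of §62.5 — follows from `U101 ≥ 0`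
whenever `(b0 a2 − a0 b2)·(a0 (b1 − g1) − a1 (b0 − g0)) ≤ 0`, i.e. whenever the world shift of
`y` and the deviation of the PIVOTAL `x`-mean from the world-0 `x`-mean have the same sign
(`(q₁ − q₀)·(p_Π − p₀) ≥ 0`); its mirror uses `U011` and `(p₁ − p₀)·(q_Π − q₀) ≥ 0`.  THEOREMS:
`pureChain_functional_nonneg_of_pivotalX` / `_pivotalY` — the pure chain functional at EVERY
`ρ ∈ [0, 1]`, general increasing markers, under that sign condition; `darc_of_pureChain_of_pivotalX`
/ `_pivotalY` — row 2′DARC at the pure AND-switch chain with point markers under the sign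
condition on the chain data.  In the anti-aligned pattern `ε > 0 > φ` the condition reads
`p_Π ≤ p₀` (resp. `q_Π ≥ q₀`): exact census on real heads (n = 3, 4; all pairs of up-set
markers) — one of the two holds in 97.2 % (n = 3) and 99.4 % (n = 4) of the anti-aligned checks,
the residual regime being `p_Π > p₁ > p₀` together with `q_Π < q₁ < q₀` (work/py/fourU.py).
-/

namespace Summit.Ventures.PercRepro2.Coin

open Classical

section PivotalMeanAlg

variable {R : Type*} [CommRing R]

/-- **The identity behind the sign condition** — `a0²·U111 + (b0 − g0)·Δ` written through the
mixed-centre functional `U101` and the pivotal `x`-moment. -/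
lemma qprime_pivotalX_identity (a0 a1 a2 b0 b1 b2 g0 g1 g2 g12 : R) :
    a0 ^ 2 * (b0 * b0 * g12 - b0 * b2 * g1 - b0 * b1 * g2 + b1 * b2 * g0)
      + (b0 - g0) * ((b0 * a1 - a0 * b1) * (b0 * a2 - a0 * b2))
    = a0 * b0 * (b0 * a0 * g12 - b0 * a2 * g1 - a0 * b1 * g2 + b1 * a2 * g0)
      - b0 * ((b0 * a2 - a0 * b2) * (a0 * (b1 - g1) - a1 * (b0 - g0))) := by ring

/-- The mirror identity through `U011` and the pivotal `y`-moment. -/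
lemma qprime_pivotalY_identity (a0 a1 a2 b0 b1 b2 g0 g1 g2 g12 : R) :
    a0 ^ 2 * (b0 * b0 * g12 - b0 * b2 * g1 - b0 * b1 * g2 + b1 * b2 * g0)
      + (b0 - g0) * ((b0 * a1 - a0 * b1) * (b0 * a2 - a0 * b2))
    = a0 * b0 * (a0 * b0 * g12 - a0 * b2 * g1 - b0 * a1 * g2 + a1 * b2 * g0)
      - b0 * ((b0 * a1 - a0 * b1) * (a0 * (b2 - g2) - a2 * (b0 - g0))) := by ring

end PivotalMeanAlg

section PivotalMeanOrd

variable {R : Type*} [Field R] [LinearOrder R] [IsStrictOrderedRing R]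

/-- (Q′) from `U101 ≥ 0` and the `x`-sign condition. -/
lemma qprime_of_pivotalX_alg (a0 a1 a2 b0 b1 b2 g0 g1 g2 g12 : R) (ha0 : 0 ≤ a0) (hb0 : 0 ≤ b0)
    (hU101 : 0 ≤ b0 * a0 * g12 - b0 * a2 * g1 - a0 * b1 * g2 + b1 * a2 * g0)
    (hsign : (b0 * a2 - a0 * b2) * (a0 * (b1 - g1) - a1 * (b0 - g0)) ≤ 0) :
    0 ≤ a0 ^ 2 * (b0 * b0 * g12 - b0 * b2 * g1 - b0 * b1 * g2 + b1 * b2 * g0)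
      + (b0 - g0) * ((b0 * a1 - a0 * b1) * (b0 * a2 - a0 * b2)) := by
  rw [qprime_pivotalX_identity]
  have h1 : 0 ≤ a0 * b0 * (b0 * a0 * g12 - b0 * a2 * g1 - a0 * b1 * g2 + b1 * a2 * g0) :=
    mul_nonneg (mul_nonneg ha0 hb0) hU101
  have h2 : b0 * ((b0 * a2 - a0 * b2) * (a0 * (b1 - g1) - a1 * (b0 - g0))) ≤ 0 :=
    mul_nonpos_of_nonneg_of_nonpos hb0 hsign
  linarith

/-- (Q′) from `U011 ≥ 0` and the `y`-sign condition. -/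
lemma qprime_of_pivotalY_alg (a0 a1 a2 b0 b1 b2 g0 g1 g2 g12 : R) (ha0 : 0 ≤ a0) (hb0 : 0 ≤ b0)
    (hU011 : 0 ≤ a0 * b0 * g12 - a0 * b2 * g1 - b0 * a1 * g2 + a1 * b2 * g0)
    (hsign : (b0 * a1 - a0 * b1) * (a0 * (b2 - g2) - a2 * (b0 - g0)) ≤ 0) :
    0 ≤ a0 ^ 2 * (b0 * b0 * g12 - b0 * b2 * g1 - b0 * b1 * g2 + b1 * b2 * g0)
      + (b0 - g0) * ((b0 * a1 - a0 * b1) * (b0 * a2 - a0 * b2)) := by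
  rw [qprime_pivotalY_identity]
  have h1 : 0 ≤ a0 * b0 * (a0 * b0 * g12 - a0 * b2 * g1 - b0 * a1 * g2 + a1 * b2 * g0) :=
    mul_nonneg (mul_nonneg ha0 hb0) hU011
  have h2 : b0 * ((b0 * a1 - a0 * b1) * (a0 * (b2 - g2) - a2 * (b0 - g0))) ≤ 0 :=
    mul_nonpos_of_nonneg_of_nonpos hb0 hsign
  linarith

end PivotalMeanOrd

section PivotalMeanMain

variable {V : Type*} [DecidableEq V] {R : Type*} [Field R] [LinearOrder R] [IsStrictOrderedRing R]

/-- **THE UNIVERSAL PURE CHAIN FROM THE `x`-SIGN CONDITION ON THE PIVOTAL LAW.** Notation as in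
`pureChain_functional_nonneg_of_Qprime`: `a0 a1 a2` the world-0 moments of `ν c`, `b0 b1 b2` those
of the world-1 `R`-law `ν·chainMix ∅ ent' 1 c d`, `g0 g1 g2` those of the world-1 gate
`ν·chainMix ∅ ent' 1 c d'`.  Under the head hypotheses and positive world masses, if
`(b0 a2 − a0 b2)·(a0 (b1 − g1) − a1 (b0 − g0)) ≤ 0` — the world shift of `y` and the deviation of
the pivotal `x`-mean from the world-0 `x`-mean have the same sign — then the pure chain
functional is nonnegative at EVERY `ρ ∈ [0, 1]` for every pair of nonnegative increasing markers. -/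
theorem pureChain_functional_nonneg_of_pivotalX (U ent' : Finset V) (ν c d d' : Finset V → R)
    (ρ : R) (hρ0 : 0 ≤ ρ) (hρ1 : ρ ≤ 1) (hν0 : ∀ W, 0 ≤ ν W)
    (hν : ∀ s ⊆ U, ∀ t ⊆ U, ν s * ν t ≤ ν (s ∩ t) * ν (s ∪ t))
    (hc0 : ∀ W, 0 ≤ c W) (hd0 : ∀ W, 0 ≤ d W) (hd'0 : ∀ W, 0 ≤ d' W)
    (hdc : ∀ W, d W ≤ c W) (hd'c : ∀ W, d' W ≤ c W)
    (hcc : ∀ s t, c s * c t ≤ c (s ∩ t) * c (s ∪ t))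
    (hdd : ∀ s t, d s * d t ≤ d (s ∩ t) * d (s ∪ t))
    (hd'd' : ∀ s t, d' s * d' t ≤ d' (s ∩ t) * d' (s ∪ t))
    (hcd : ∀ s t, c s * d t ≤ c (s ∩ t) * d (s ∪ t))
    (hcd' : ∀ s t, c s * d' t ≤ c (s ∩ t) * d' (s ∪ t))
    (hdd' : ∀ s t, d s * d' t ≤ d (s ∩ t) * d' (s ∪ t))
    (hratio : ∀ s t, s ⊆ t → d s * c t ≤ c s * d t)
    (hratio' : ∀ s t, s ⊆ t → d' s * c t ≤ c s * d' t)
    (x y : Finset V → R) (hx0 : ∀ W, 0 ≤ x W) (hy0 : ∀ W, 0 ≤ y W)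
    (hxm : ∀ s t, x s ≤ x (s ∪ t)) (hym : ∀ s t, y s ≤ y (s ∪ t))
    (hpos0 : 0 < ∑ W ∈ U.powerset, ν W * c W)
    (hpos1 : 0 < ∑ W ∈ U.powerset, ν W * chainMix ∅ ent' 1 c d W)
    (hsign : ((∑ W ∈ U.powerset, ν W * chainMix ∅ ent' 1 c d W) * (∑ W ∈ U.powerset, ν W * c W * y W)
          - (∑ W ∈ U.powerset, ν W * c W) * (∑ W ∈ U.powerset, ν W * chainMix ∅ ent' 1 c d W * y W)) *
        ((∑ W ∈ U.powerset, ν W * c W) *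
            ((∑ W ∈ U.powerset, ν W * chainMix ∅ ent' 1 c d W * x W)
              - (∑ W ∈ U.powerset, ν W * chainMix ∅ ent' 1 c d' W * x W))
          - (∑ W ∈ U.powerset, ν W * c W * x W) *
            ((∑ W ∈ U.powerset, ν W * chainMix ∅ ent' 1 c d W)
              - (∑ W ∈ U.powerset, ν W * chainMix ∅ ent' 1 c d' W))) ≤ 0) :
    0 ≤ (∑ W ∈ U.powerset, ν W * chainMix ∅ ent' ρ c d W) ^ 2 *
          (∑ W ∈ U.powerset, ν W * chainMix ∅ ent' ρ c d' W * (x W * y W))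
        - (∑ W ∈ U.powerset, ν W * chainMix ∅ ent' ρ c d W) *
          (∑ W ∈ U.powerset, ν W * chainMix ∅ ent' ρ c d W * x W) *
          (∑ W ∈ U.powerset, ν W * chainMix ∅ ent' ρ c d' W * y W)
        - (∑ W ∈ U.powerset, ν W * chainMix ∅ ent' ρ c d W) *
          (∑ W ∈ U.powerset, ν W * chainMix ∅ ent' ρ c d W * y W) *
          (∑ W ∈ U.powerset, ν W * chainMix ∅ ent' ρ c d' W * x W)
        + (∑ W ∈ U.powerset, ν W * chainMix ∅ ent' ρ c d W * x W) *
          (∑ W ∈ U.powerset, ν W * chainMix ∅ ent' ρ c d W * y W) *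
          (∑ W ∈ U.powerset, ν W * chainMix ∅ ent' ρ c d' W) := by
  have hU101 := chain_world1_mixed_nonneg U ∅ ent' ν c d d' 1 0 zero_le_one le_rfl le_rfl
    zero_le_one hν0 hν hc0 hd0 hd'0 hdc hd'c hcc hdd hd'd' hcd hcd' hdd' hratio hratio' x y hx0 hy0 hxm hym
  simp only [chainMix_zero_empty] at hU101
  have hQ := qprime_of_pivotalX_alg _ _ _ _ _ _ _ _ _ _ hpos0.le hpos1.le hU101 hsign
  exact pureChain_functional_nonneg_of_Qprime U ent' ν c d d' ρ hρ0 hρ1 hν0 hν hc0 hd0 hd'0 hdc hd'c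
    hcc hdd hd'd' hcd hcd' hdd' hratio hratio' x y hx0 hy0 hxm hym hpos0 hpos1 hQ

/-- **THE UNIVERSAL PURE CHAIN FROM THE `y`-SIGN CONDITION ON THE PIVOTAL LAW** (the mirror:
`(b0 a1 − a0 b1)·(a0 (b2 − g2) − a2 (b0 − g0)) ≤ 0`). -/
theorem pureChain_functional_nonneg_of_pivotalY (U ent' : Finset V) (ν c d d' : Finset V → R)
    (ρ : R) (hρ0 : 0 ≤ ρ) (hρ1 : ρ ≤ 1) (hν0 : ∀ W, 0 ≤ ν W)
    (hν : ∀ s ⊆ U, ∀ t ⊆ U, ν s * ν t ≤ ν (s ∩ t) * ν (s ∪ t))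
    (hc0 : ∀ W, 0 ≤ c W) (hd0 : ∀ W, 0 ≤ d W) (hd'0 : ∀ W, 0 ≤ d' W)
    (hdc : ∀ W, d W ≤ c W) (hd'c : ∀ W, d' W ≤ c W)
    (hcc : ∀ s t, c s * c t ≤ c (s ∩ t) * c (s ∪ t))
    (hdd : ∀ s t, d s * d t ≤ d (s ∩ t) * d (s ∪ t))
    (hd'd' : ∀ s t, d' s * d' t ≤ d' (s ∩ t) * d' (s ∪ t))
    (hcd : ∀ s t, c s * d t ≤ c (s ∩ t) * d (s ∪ t))
    (hcd' : ∀ s t, c s * d' t ≤ c (s ∩ t) * d' (s ∪ t))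
    (hdd' : ∀ s t, d s * d' t ≤ d (s ∩ t) * d' (s ∪ t))
    (hratio : ∀ s t, s ⊆ t → d s * c t ≤ c s * d t)
    (hratio' : ∀ s t, s ⊆ t → d' s * c t ≤ c s * d' t)
    (x y : Finset V → R) (hx0 : ∀ W, 0 ≤ x W) (hy0 : ∀ W, 0 ≤ y W)
    (hxm : ∀ s t, x s ≤ x (s ∪ t)) (hym : ∀ s t, y s ≤ y (s ∪ t))
    (hpos0 : 0 < ∑ W ∈ U.powerset, ν W * c W)
    (hpos1 : 0 < ∑ W ∈ U.powerset, ν W * chainMix ∅ ent' 1 c d W)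
    (hsign : ((∑ W ∈ U.powerset, ν W * chainMix ∅ ent' 1 c d W) * (∑ W ∈ U.powerset, ν W * c W * x W)
          - (∑ W ∈ U.powerset, ν W * c W) * (∑ W ∈ U.powerset, ν W * chainMix ∅ ent' 1 c d W * x W)) *
        ((∑ W ∈ U.powerset, ν W * c W) *
            ((∑ W ∈ U.powerset, ν W * chainMix ∅ ent' 1 c d W * y W)
              - (∑ W ∈ U.powerset, ν W * chainMix ∅ ent' 1 c d' W * y W))
          - (∑ W ∈ U.powerset, ν W * c W * y W) *
            ((∑ W ∈ U.powerset, ν W * chainMix ∅ ent' 1 c d W)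
              - (∑ W ∈ U.powerset, ν W * chainMix ∅ ent' 1 c d' W))) ≤ 0) :
    0 ≤ (∑ W ∈ U.powerset, ν W * chainMix ∅ ent' ρ c d W) ^ 2 *
          (∑ W ∈ U.powerset, ν W * chainMix ∅ ent' ρ c d' W * (x W * y W))
        - (∑ W ∈ U.powerset, ν W * chainMix ∅ ent' ρ c d W) *
          (∑ W ∈ U.powerset, ν W * chainMix ∅ ent' ρ c d W * x W) *
          (∑ W ∈ U.powerset, ν W * chainMix ∅ ent' ρ c d' W * y W)
        - (∑ W ∈ U.powerset, ν W * chainMix ∅ ent' ρ c d W) *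
          (∑ W ∈ U.powerset, ν W * chainMix ∅ ent' ρ c d W * y W) *
          (∑ W ∈ U.powerset, ν W * chainMix ∅ ent' ρ c d' W * x W)
        + (∑ W ∈ U.powerset, ν W * chainMix ∅ ent' ρ c d W * x W) *
          (∑ W ∈ U.powerset, ν W * chainMix ∅ ent' ρ c d W * y W) *
          (∑ W ∈ U.powerset, ν W * chainMix ∅ ent' ρ c d' W) := by
  have hU011 := chain_world1_mixed_nonneg U ∅ ent' ν c d d' 0 1 le_rfl zero_le_one zero_le_one
    le_rfl hν0 hν hc0 hd0 hd'0 hdc hd'c hcc hdd hd'd' hcd hcd' hdd' hratio hratio' x y hx0 hy0 hxm hym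
  simp only [chainMix_zero_empty] at hU011
  have hQ := qprime_of_pivotalY_alg _ _ _ _ _ _ _ _ _ _ hpos0.le hpos1.le hU011 hsign
  exact pureChain_functional_nonneg_of_Qprime U ent' ν c d d' ρ hρ0 hρ1 hν0 hν hc0 hd0 hd'0 hdc hd'c
    hcc hdd hd'd' hcd hcd' hdd' hratio hratio' x y hx0 hy0 hxm hym hpos0 hpos1 hQ

end PivotalMeanMain

section PivotalMeanDarc

variable {V : Type*} {E : Type*} [Fintype V] [DecidableEq V] [Fintype E] [DecidableEq E]
  {R : Type*} [Field R] [LinearOrder R] [IsStrictOrderedRing R]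
  {arcs : E → Finset (V × V)} {s : V} {U : Finset V} {ent' : Finset V} {c' : V → E}
  {a' a w : V} {c : V → E}

/-- **ROW 2′DARC AT THE PURE AND-SWITCH CHAIN FROM THE `x`-SIGN CONDITION ON THE PIVOTAL LAW**
(chain data `ν = P(level)`, `c = chainC`, `d = chainD`, `d' = chainD'`, point markers `m₁, m₂`,
positive world masses): if the world shift of `m₂` and the deviation of the pivotal `m₁`-mean from
the world-0 `m₁`-mean have the same sign, `DARC pr arcs s {t} m₁ m₂ a w`. -/
theorem darc_of_pureChain_of_pivotalX (pr : E → R) (hp : IsProbVec pr) (hS : SameEnds arcs)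
    (h' : OrTailK arcs s U ent' c' a') (hsure' : ∀ r ∈ ent', pr (c' r) = 1)
    (h : OrTailK arcs s (insert a' U) (insert a' ∅) c a)
    {m₁ m₂ : V} (hm₁ : m₁ ∈ U) (hm₂ : m₂ ∈ U)
    (hν : ∀ W W', W ⊆ U → W' ⊆ U →
      prob pr (coreLevel arcs s U W) * prob pr (coreLevel arcs s U W') ≤
        prob pr (coreLevel arcs s U (W ∩ W')) * prob pr (coreLevel arcs s U (W ∪ W')))
    {t : V} (htC : t ∉ insert a (insert a' U)) (hts : t ≠ s) (hws : w ≠ s)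
    (hwC : w ∉ insert a (insert a' U))
    (hpos0 : 0 < ∑ W ∈ U.powerset, prob pr (coreLevel arcs s U W) * chainC pr arcs s t U ent' a' a W)
    (hpos1 : 0 < ∑ W ∈ U.powerset, prob pr (coreLevel arcs s U W) *
      chainMix ∅ ent' 1 (chainC pr arcs s t U ent' a' a) (chainD pr arcs s t U ent' a' a) W)
    (hsign : ((∑ W ∈ U.powerset, prob pr (coreLevel arcs s U W) *
            chainMix ∅ ent' 1 (chainC pr arcs s t U ent' a' a) (chainD pr arcs s t U ent' a' a) W) *
          (∑ W ∈ U.powerset, prob pr (coreLevel arcs s U W) * chainC pr arcs s t U ent' a' a W *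
            (if m₂ ∈ W then (1 : R) else 0))
          - (∑ W ∈ U.powerset, prob pr (coreLevel arcs s U W) * chainC pr arcs s t U ent' a' a W) *
          (∑ W ∈ U.powerset, prob pr (coreLevel arcs s U W) *
            chainMix ∅ ent' 1 (chainC pr arcs s t U ent' a' a) (chainD pr arcs s t U ent' a' a) W *
            (if m₂ ∈ W then (1 : R) else 0))) *
        ((∑ W ∈ U.powerset, prob pr (coreLevel arcs s U W) * chainC pr arcs s t U ent' a' a W) *
            ((∑ W ∈ U.powerset, prob pr (coreLevel arcs s U W) *
                chainMix ∅ ent' 1 (chainC pr arcs s t U ent' a' a) (chainD pr arcs s t U ent' a' a) W *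
                (if m₁ ∈ W then (1 : R) else 0))
              - (∑ W ∈ U.powerset, prob pr (coreLevel arcs s U W) *
                chainMix ∅ ent' 1 (chainC pr arcs s t U ent' a' a) (chainD' pr arcs s t U ent' a' a w) W *
                (if m₁ ∈ W then (1 : R) else 0)))
          - (∑ W ∈ U.powerset, prob pr (coreLevel arcs s U W) * chainC pr arcs s t U ent' a' a W *
              (if m₁ ∈ W then (1 : R) else 0)) *
            ((∑ W ∈ U.powerset, prob pr (coreLevel arcs s U W) *
                chainMix ∅ ent' 1 (chainC pr arcs s t U ent' a' a) (chainD pr arcs s t U ent' a' a) W)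
              - (∑ W ∈ U.powerset, prob pr (coreLevel arcs s U W) *
                chainMix ∅ ent' 1 (chainC pr arcs s t U ent' a' a) (chainD' pr arcs s t U ent' a' a w) W))) ≤ 0) :
    DARC pr arcs s {t} m₁ m₂ a w := by
  obtain ⟨hA0, hAmono, hAlsm⟩ := OrTailU.head_props (U := insert a' U) (a := a) pr hp hS t
  obtain ⟨hdc, hd'd, hcc, hdd, hd'd', hdd', hratio, hratio', -, hcd, hcd'⟩ :=
    chainPhi_head_hyps (fun X => prob pr (coreAvoidEvent arcs s t (insert a (insert a' U)) X))
      ent' a' a w hA0 hAmono hAlsm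
  have hx0 : ∀ W : Finset V, (0 : R) ≤ (if m₁ ∈ W then (1 : R) else 0) := by
    intro W; split_ifs <;> norm_num
  have hy0 : ∀ W : Finset V, (0 : R) ≤ (if m₂ ∈ W then (1 : R) else 0) := by
    intro W; split_ifs <;> norm_num
  have hxm : ∀ s t : Finset V,
      (if m₁ ∈ s then (1 : R) else 0) ≤ (if m₁ ∈ s ∪ t then (1 : R) else 0) := by
    intro s t
    by_cases h : m₁ ∈ s
    · rw [if_pos h, if_pos (Finset.mem_union_left t h)]
    · rw [if_neg h]; split_ifs <;> norm_num
  have hym : ∀ s t : Finset V,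
      (if m₂ ∈ s then (1 : R) else 0) ≤ (if m₂ ∈ s ∪ t then (1 : R) else 0) := by
    intro s t
    by_cases h : m₂ ∈ s
    · rw [if_pos h, if_pos (Finset.mem_union_left t h)]
    · rw [if_neg h]; split_ifs <;> norm_num
  refine chain_darc_of_functional pr hS h' hsure' h (by simp) (Finset.empty_subset _) hm₁ hm₂ htC hts hws hwC ?_
  exact pureChain_functional_nonneg_of_pivotalX U ent' (fun W => prob pr (coreLevel arcs s U W))
    (chainC pr arcs s t U ent' a' a) (chainD pr arcs s t U ent' a' a) (chainD' pr arcs s t U ent' a' a w)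
    (pr (c a')) (hp.nonneg _) (hp.le_one _) (fun W => prob_nonneg hp _)
    (fun s' hs' t' ht' => hν s' t' hs' ht') (fun W => hA0 _) (fun W => hA0 _) (fun W => hA0 _)
    hdc (fun W => le_trans (hd'd W) (hdc W)) hcc hdd hd'd' hcd hcd' hdd' hratio hratio'
    (fun W => if m₁ ∈ W then (1 : R) else 0) (fun W => if m₂ ∈ W then (1 : R) else 0)
    hx0 hy0 hxm hym hpos0 hpos1 hsign

/-- **ROW 2′DARC AT THE PURE AND-SWITCH CHAIN FROM THE `y`-SIGN CONDITION ON THE PIVOTAL LAW**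
(the mirror of `darc_of_pureChain_of_pivotalX`). -/
theorem darc_of_pureChain_of_pivotalY (pr : E → R) (hp : IsProbVec pr) (hS : SameEnds arcs)
    (h' : OrTailK arcs s U ent' c' a') (hsure' : ∀ r ∈ ent', pr (c' r) = 1)
    (h : OrTailK arcs s (insert a' U) (insert a' ∅) c a)
    {m₁ m₂ : V} (hm₁ : m₁ ∈ U) (hm₂ : m₂ ∈ U)
    (hν : ∀ W W', W ⊆ U → W' ⊆ U →
      prob pr (coreLevel arcs s U W) * prob pr (coreLevel arcs s U W') ≤
        prob pr (coreLevel arcs s U (W ∩ W')) * prob pr (coreLevel arcs s U (W ∪ W')))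
    {t : V} (htC : t ∉ insert a (insert a' U)) (hts : t ≠ s) (hws : w ≠ s)
    (hwC : w ∉ insert a (insert a' U))
    (hpos0 : 0 < ∑ W ∈ U.powerset, prob pr (coreLevel arcs s U W) * chainC pr arcs s t U ent' a' a W)
    (hpos1 : 0 < ∑ W ∈ U.powerset, prob pr (coreLevel arcs s U W) *
      chainMix ∅ ent' 1 (chainC pr arcs s t U ent' a' a) (chainD pr arcs s t U ent' a' a) W)
    (hsign : ((∑ W ∈ U.powerset, prob pr (coreLevel arcs s U W) *
            chainMix ∅ ent' 1 (chainC pr arcs s t U ent' a' a) (chainD pr arcs s t U ent' a' a) W) *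
          (∑ W ∈ U.powerset, prob pr (coreLevel arcs s U W) * chainC pr arcs s t U ent' a' a W *
            (if m₁ ∈ W then (1 : R) else 0))
          - (∑ W ∈ U.powerset, prob pr (coreLevel arcs s U W) * chainC pr arcs s t U ent' a' a W) *
          (∑ W ∈ U.powerset, prob pr (coreLevel arcs s U W) *
            chainMix ∅ ent' 1 (chainC pr arcs s t U ent' a' a) (chainD pr arcs s t U ent' a' a) W *
            (if m₁ ∈ W then (1 : R) else 0))) *
        ((∑ W ∈ U.powerset, prob pr (coreLevel arcs s U W) * chainC pr arcs s t U ent' a' a W) *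
            ((∑ W ∈ U.powerset, prob pr (coreLevel arcs s U W) *
                chainMix ∅ ent' 1 (chainC pr arcs s t U ent' a' a) (chainD pr arcs s t U ent' a' a) W *
                (if m₂ ∈ W then (1 : R) else 0))
              - (∑ W ∈ U.powerset, prob pr (coreLevel arcs s U W) *
                chainMix ∅ ent' 1 (chainC pr arcs s t U ent' a' a) (chainD' pr arcs s t U ent' a' a w) W *
                (if m₂ ∈ W then (1 : R) else 0)))
          - (∑ W ∈ U.powerset, prob pr (coreLevel arcs s U W) * chainC pr arcs s t U ent' a' a W *
              (if m₂ ∈ W then (1 : R) else 0)) *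
            ((∑ W ∈ U.powerset, prob pr (coreLevel arcs s U W) *
                chainMix ∅ ent' 1 (chainC pr arcs s t U ent' a' a) (chainD pr arcs s t U ent' a' a) W)
              - (∑ W ∈ U.powerset, prob pr (coreLevel arcs s U W) *
                chainMix ∅ ent' 1 (chainC pr arcs s t U ent' a' a) (chainD' pr arcs s t U ent' a' a w) W))) ≤ 0) :
    DARC pr arcs s {t} m₁ m₂ a w := by
  obtain ⟨hA0, hAmono, hAlsm⟩ := OrTailU.head_props (U := insert a' U) (a := a) pr hp hS t
  obtain ⟨hdc, hd'd, hcc, hdd, hd'd', hdd', hratio, hratio', -, hcd, hcd'⟩ :=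
    chainPhi_head_hyps (fun X => prob pr (coreAvoidEvent arcs s t (insert a (insert a' U)) X))
      ent' a' a w hA0 hAmono hAlsm
  have hx0 : ∀ W : Finset V, (0 : R) ≤ (if m₁ ∈ W then (1 : R) else 0) := by
    intro W; split_ifs <;> norm_num
  have hy0 : ∀ W : Finset V, (0 : R) ≤ (if m₂ ∈ W then (1 : R) else 0) := by
    intro W; split_ifs <;> norm_num
  have hxm : ∀ s t : Finset V,
      (if m₁ ∈ s then (1 : R) else 0) ≤ (if m₁ ∈ s ∪ t then (1 : R) else 0) := by
    intro s t
    by_cases h : m₁ ∈ s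
    · rw [if_pos h, if_pos (Finset.mem_union_left t h)]
    · rw [if_neg h]; split_ifs <;> norm_num
  have hym : ∀ s t : Finset V,
      (if m₂ ∈ s then (1 : R) else 0) ≤ (if m₂ ∈ s ∪ t then (1 : R) else 0) := by
    intro s t
    by_cases h : m₂ ∈ s
    · rw [if_pos h, if_pos (Finset.mem_union_left t h)]
    · rw [if_neg h]; split_ifs <;> norm_num
  refine chain_darc_of_functional pr hS h' hsure' h (by simp) (Finset.empty_subset _) hm₁ hm₂ htC hts hws hwC ?_
  exact pureChain_functional_nonneg_of_pivotalY U ent' (fun W => prob pr (coreLevel arcs s U W))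
    (chainC pr arcs s t U ent' a' a) (chainD pr arcs s t U ent' a' a) (chainD' pr arcs s t U ent' a' a w)
    (pr (c a')) (hp.nonneg _) (hp.le_one _) (fun W => prob_nonneg hp _)
    (fun s' hs' t' ht' => hν s' t' hs' ht') (fun W => hA0 _) (fun W => hA0 _) (fun W => hA0 _)
    hdc (fun W => le_trans (hd'd W) (hdc W)) hcc hdd hd'd' hcd hcd' hdd' hratio hratio'
    (fun W => if m₁ ∈ W then (1 : R) else 0) (fun W => if m₂ ∈ W then (1 : R) else 0)
    hx0 hy0 hxm hym hpos0 hpos1 hsign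

end PivotalMeanDarc

end Summit.Ventures.PercRepro2.Coin
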